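import Mathlib
import Summits.Ventures.PercRepro2.CaseOneTwoMarkBern
import Summits.Ventures.PercRepro2.HalfLTwoMarkMassesB
import Summits.Ventures.PercRepro2.HalfLTwoMarkNonneg

/-!
# The eight blocks are nonnegative on the cells of a probability vector (blind cell PercRepro2, night-1 g37)

For `p00 = p[eo ↦ 0][eb ↦ 0]` a probability vector, the nine cells are nonnegative (`cellsNonneg`) and
the eight blocks of `HalfLTwoMarkPoly` are the BHK06 inequalities of the base law in cell form
(`blocksNonneg`): `blkLL`, `blkHH` — Thm 1.3 in `C(a₁)`, `C(a₂)` (`bhk_same_cluster_events`,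
`CaseOne.tm_bhk_same_a2`); `blkLLN`, `blkHHN` — Thm 1.4 (`CaseOne.tm_bhk_cross_o1_b2`, `tm_bhk_cross_b1_o2`);
`blkM1`, `blkM2`, `blkM1o`, `blkM2o` — Thm 1.4 with a root cluster avoiding `{other root, mark}`
(`bhk_cross_cluster_avoid`, `CaseOne.tm_bhk_avoid_c1`).
-/

namespace Summit.Ventures.PercRepro2

namespace HalfLTwoMark

open CaseOne

section Blocks

variable {V : Type*} {E : Type*} [Fintype E] [DecidableEq E] [Fintype V] [DecidableEq V]
  {R : Type*} [Field R] [LinearOrder R] [IsStrictOrderedRing R]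

omit [Fintype V] [DecidableEq V] in
/-- The cells of a probability vector are nonnegative. -/
theorem cellsNonneg (p : E → R) (hp : IsProbVec p) (ends : E → Sym2 V) (o a₁ a₂ b : V) (eo eb : E) :
    (cellsOf p ends o a₁ a₂ b eo eb).Nonneg := by
  have hp00 : IsProbVec (Function.update (Function.update p eo 0) eb 0) :=
    (hp.update eo le_rfl zero_le_one).update eb le_rfl zero_le_one
  unfold Cells.Nonneg cellsOf
  dsimp only
  exact ⟨prob_nonneg hp00 _, prob_nonneg hp00 _, prob_nonneg hp00 _, prob_nonneg hp00 _,
    prob_nonneg hp00 _, prob_nonneg hp00 _, prob_nonneg hp00 _, prob_nonneg hp00 _, prob_nonneg hp00 _⟩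

omit [Fintype E] [DecidableEq E] [Fintype V] [LinearOrder R] [IsStrictOrderedRing R] in
/-- `avoidAll a₁ {a₂, b} = Q₀ ∩ B₁ᶜ`. -/
lemma avoidAll_pair_eq (ends : E → Sym2 V) (a₁ a₂ x : V) :
    avoidAll ends a₁ {a₂, x} = (connEvent ends a₁ a₂)ᶜ ∩ (connEvent ends a₁ x)ᶜ := by
  ext ω
  simp only [mem_avoidAll, Finset.mem_insert, Finset.mem_singleton, Set.mem_inter_iff,
    Set.mem_compl_iff, mem_connEvent]
  constructor
  · intro hh
    exact ⟨hh a₂ (Or.inl rfl), hh x (Or.inr rfl)⟩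
  · rintro ⟨h1, h2⟩ y hy
    rcases hy with rfl | rfl
    · exact h1
    · exact h2

omit [Fintype V] [DecidableEq V] [LinearOrder R] [IsStrictOrderedRing R] in
/-- `Q₀ ∩ B₁ᶜ = Q₀` with the `b ∈ C₁` part removed: `P(Q₀ ∩ B₁ᶜ) = P(Q₀) − P(Q₀ ∩ B₁)`. -/
lemma prob_Q_compl (p : E → R) (ends : E → Sym2 V) (a₁ a₂ x : V) :
    prob p ((connEvent ends a₁ a₂)ᶜ ∩ (connEvent ends a₁ x)ᶜ) =
      prob p (connEvent ends a₁ a₂)ᶜ - prob p ((connEvent ends a₁ a₂)ᶜ ∩ connEvent ends a₁ x) := by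
  have := prob_inter_add_prob_inter_compl p (connEvent ends a₁ a₂)ᶜ (connEvent ends a₁ x)
  linear_combination this

/-- **BHK 1.4 with `C(a₁)` avoiding `{a₂, b}`, `o ∈ C(a₁)` against `b ∈ C(a₂)`** (the block `M1`):
`P(Q₀,O₁,B₂) · (P(Q₀) − P(Q₀,B₁)) ≤ (P(Q₀,O₁) − P(Q₀,O₁,B₁)) · P(Q₀,B₂)`. -/
lemma bhk_avoid_M1 (p : E → R) (hp : IsProbVec p) (ends : E → Sym2 V) (o a₁ a₂ b : V) :
    prob p ((connEvent ends a₁ a₂)ᶜ ∩ connEvent ends a₁ o ∩ connEvent ends a₂ b) *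
        (prob p (connEvent ends a₁ a₂)ᶜ - prob p ((connEvent ends a₁ a₂)ᶜ ∩ connEvent ends a₁ b)) ≤
      (prob p ((connEvent ends a₁ a₂)ᶜ ∩ connEvent ends a₁ o) -
          prob p ((connEvent ends a₁ a₂)ᶜ ∩ connEvent ends a₁ o ∩ connEvent ends a₁ b)) *
        prob p ((connEvent ends a₁ a₂)ᶜ ∩ connEvent ends a₂ b) := by
  have h := bhk_cross_cluster_avoid p hp ends a₁ a₂ (X := {a₂, b}) (by simp)
    (isUpperSet_mem_setOf o) (isUpperSet_mem_setOf b)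
  rw [← connEvent_eq_clusterInEvent, ← connEvent_eq_clusterInEvent, avoidAll_pair_eq] at h
  have e1 : connEvent ends a₁ o ∩ connEvent ends a₂ b ∩
      ((connEvent ends a₁ a₂)ᶜ ∩ (connEvent ends a₁ b)ᶜ) =
      (connEvent ends a₁ a₂)ᶜ ∩ connEvent ends a₁ o ∩ connEvent ends a₂ b := by
    ext ω
    simp only [Set.mem_inter_iff, Set.mem_compl_iff, mem_connEvent]
    constructor
    · rintro ⟨⟨ho, hb⟩, hq, _⟩
      exact ⟨⟨hq, ho⟩, hb⟩
    · rintro ⟨⟨hq, ho⟩, hb⟩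
      exact ⟨⟨ho, hb⟩, hq, fun hb1 => hq (conn_trans hb1 (conn_symm hb))⟩
  have e2 : connEvent ends a₁ o ∩ ((connEvent ends a₁ a₂)ᶜ ∩ (connEvent ends a₁ b)ᶜ) =
      ((connEvent ends a₁ a₂)ᶜ ∩ connEvent ends a₁ o) ∩ (connEvent ends a₁ b)ᶜ := by
    ext ω
    simp only [Set.mem_inter_iff, Set.mem_compl_iff]
    tauto
  have e3 : connEvent ends a₂ b ∩ ((connEvent ends a₁ a₂)ᶜ ∩ (connEvent ends a₁ b)ᶜ) =
      (connEvent ends a₁ a₂)ᶜ ∩ connEvent ends a₂ b := by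
    ext ω
    simp only [Set.mem_inter_iff, Set.mem_compl_iff, mem_connEvent]
    constructor
    · rintro ⟨hb, hq, _⟩
      exact ⟨hq, hb⟩
    · rintro ⟨hq, hb⟩
      exact ⟨hb, hq, fun hb1 => hq (conn_trans hb1 (conn_symm hb))⟩
  rw [prob_congr_set p e1, prob_congr_set p e2, prob_congr_set p e3, prob_Q_compl] at h
  have c := prob_inter_add_prob_inter_compl p ((connEvent ends a₁ a₂)ᶜ ∩ connEvent ends a₁ o)
    (connEvent ends a₁ b)
  have e4 : prob p ((connEvent ends a₁ a₂)ᶜ ∩ connEvent ends a₁ o ∩ (connEvent ends a₁ b)ᶜ) =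
      prob p ((connEvent ends a₁ a₂)ᶜ ∩ connEvent ends a₁ o) -
        prob p ((connEvent ends a₁ a₂)ᶜ ∩ connEvent ends a₁ o ∩ connEvent ends a₁ b) := by
    linear_combination c
  rw [e4] at h
  exact h

/-- **The eight blocks are nonnegative** on the cells of the base law of a probability vector. -/
theorem blocksNonneg (p : E → R) (hp : IsProbVec p) (ends : E → Sym2 V) (o a₁ a₂ b : V) (eo eb : E) :
    BlocksNonneg (cellsOf p ends o a₁ a₂ b eo eb) := by
  set p00 := Function.update (Function.update p eo 0) eb 0 with hp00
  have hp0 : IsProbVec p00 := (hp.update eo le_rfl zero_le_one).update eb le_rfl zero_le_one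
  -- the cell decompositions of the base masses
  have tot := total_cells p00 ends o b a₁ a₂
  have oL := split_b p00 ends b a₁ a₂ (connEvent ends a₁ o)
  have oH := split_b p00 ends b a₁ a₂ (connEvent ends a₂ o)
  have bL := split_o p00 ends o a₁ a₂ (connEvent ends a₁ b)
  have bH := split_o p00 ends o a₁ a₂ (connEvent ends a₂ b)
  have eHL : prob p00 ((connEvent ends a₁ a₂)ᶜ ∩ connEvent ends a₁ b ∩ connEvent ends a₂ o) =
      prob p00 ((connEvent ends a₁ a₂)ᶜ ∩ connEvent ends a₂ o ∩ connEvent ends a₁ b) :=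
    prob_congr_set p00 (Set.inter_right_comm _ _ _)
  have eLH : prob p00 ((connEvent ends a₁ a₂)ᶜ ∩ connEvent ends a₂ b ∩ connEvent ends a₁ o) =
      prob p00 ((connEvent ends a₁ a₂)ᶜ ∩ connEvent ends a₁ o ∩ connEvent ends a₂ b) :=
    prob_congr_set p00 (Set.inter_right_comm _ _ _)
  -- the atoms
  have hLL := bhk_same_cluster_events p00 hp0 ends a₁ a₂ (isUpperSet_mem_setOf b) (isUpperSet_mem_setOf o)
  rw [← connEvent_eq_clusterInEvent, ← connEvent_eq_clusterInEvent] at hLL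
  have e1 : connEvent ends a₁ b ∩ (connEvent ends a₁ a₂)ᶜ =
      (connEvent ends a₁ a₂)ᶜ ∩ connEvent ends a₁ b := Set.inter_comm _ _
  have e2 : connEvent ends a₁ o ∩ (connEvent ends a₁ a₂)ᶜ =
      (connEvent ends a₁ a₂)ᶜ ∩ connEvent ends a₁ o := Set.inter_comm _ _
  have e3 : connEvent ends a₁ b ∩ connEvent ends a₁ o ∩ (connEvent ends a₁ a₂)ᶜ =
      (connEvent ends a₁ a₂)ᶜ ∩ connEvent ends a₁ o ∩ connEvent ends a₁ b := by
    ext ω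
    simp only [Set.mem_inter_iff, Set.mem_compl_iff]
    tauto
  rw [prob_congr_set p00 e1, prob_congr_set p00 e2, prob_congr_set p00 e3] at hLL
  have hHH := tm_bhk_same_a2 p00 hp0 ends o a₁ a₂ b
  have hLLN := tm_bhk_cross_o1_b2 p00 hp0 ends o a₁ a₂ b
  have hHHN := tm_bhk_cross_b1_o2 p00 hp0 ends o a₁ a₂ b
  rw [eHL] at hHHN
  have hM1o := tm_bhk_avoid_c1 p00 hp0 ends o a₁ a₂ b
  rw [eHL] at hM1o
  have hM2o := tm_bhk_avoid_c1 p00 hp0 ends o a₂ a₁ b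
  rw [connEvent_comm ends a₂ a₁, eLH] at hM2o
  have hM1 := bhk_avoid_M1 p00 hp0 ends o a₁ a₂ b
  have hM2 := bhk_avoid_M1 p00 hp0 ends o a₂ a₁ b
  rw [connEvent_comm ends a₂ a₁] at hM2
  -- assemble
  unfold BlocksNonneg blkLL blkHH blkLLN blkHHN blkM1 blkM2 blkM1o blkM2o cellsOf
  dsimp only
  rw [← hp00]
  rw [tot] at hLL hHH hLLN hHHN hM1o hM2o hM1 hM2
  rw [oL] at hLL hLLN hM1o hM2o hM1
  rw [oH] at hHH hHHN hM1o hM2o hM2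
  rw [bL] at hLL hHHN hM1o hM2 hM1
  rw [bH] at hHH hLLN hM2o hM1 hM2
  refine ⟨?_, ?_, ?_, ?_, ?_, ?_, ?_, ?_⟩
  · linear_combination hLL
  · linear_combination hHH
  · linear_combination hLLN
  · linear_combination hHHN
  · linear_combination hM1
  · linear_combination hM2
  · linear_combination hM1o
  · linear_combination hM2o

end Blocks

end HalfLTwoMark

end Summit.Ventures.PercRepro2
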